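import Literature.AlgebraicTopology.SingularHomology.LerayHirschUnion
import Literature.AlgebraicTopology.SingularHomology.CohomologyHomotopyInvariance
import Mathlib.Topology.PartitionOfUnity
import Mathlib.Analysis.Convex.Basic
import HarnessLib

/-!
# Leray–Hirsch: increasing unions (Milnor's telescope)

D. Husemoller, *Fibre Bundles* (3rd ed. 1994), Ch. 17 §1 Thm. 1.1 is stated for bundles of finite
type; for the passage to an arbitrary (paracompact) base (Remark 1.2: "a limit argument") we use
J. Milnor's telescope ("On axiomatic homology theory", Pacific J. Math. 12 (1962), Lemma 1 and
its proof: the telescope `⋃ Xₙ × [n, n+1]` of an increasing sequence is the union of the two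
subsets of "even" and "odd" segments, each a disjoint union, meeting in a disjoint union), in the
form of A. Hatcher, *Algebraic Topology* (2002), §3.F p. 312 / proof of Prop. 3F.2 and §4.D.

For a map `p : E → B`, classes `cⱼ` and an increasing OPEN exhaustion `B = ⋃ Vₙ` with `θ`
bijective over every `Vₙ` (`IsLH Vₙ`), `θ` is bijective for `p` itself
(`LerayHirsch.bijective_of_exhaustion`, `B` normal paracompact). Proof: over `B × ℝ` (map
`p × 𝟙`, classes `pr₁^* cⱼ`) the open telescope `T = ⋃ₙ Vₙ × (n, n + 2)` is the union of the
disjoint unions of the even and of the odd boxes, which meet in the disjoint union of the boxes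
`Vₙ × (n + 1, n + 2)`; a box `S × J` is as good as `S` (`isLH_box_iff`, `J` an interval), so the
union and disjoint-union steps (`LerayHirschUnion`) give `θ` over `T`; finally `T → B` (and
`(p × 𝟙)⁻¹T → E`) is a homotopy equivalence — a section `b ↦ (b, h(b) + 1)` comes from a HEIGHT
FUNCTION `h = Σ n ρₙ` of a partition of unity subordinate to `(Vₙ)` (`exists_heightFun`), and the
fibres of `T → B` are the convex rays `(n_min(b), ∞)` — and `θ` is transported along it.

Everything is proved; no named facts.

## References

* D. Husemoller, *Fibre Bundles*, GTM 20, Springer 1994, Ch. 17 §1 Thm. 1.1, Rem. 1.2. [HusemollerFibreBundles1994]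
* J. Milnor, On axiomatic homology theory, Pacific J. Math. 12 (1962) 337–341, Lemma 1. [Milnor1962]
* A. Hatcher, *Algebraic Topology*, CUP 2002, §3.F p. 312, §4.D Thm. 4D.1. [HatcherAT2002]
-/

noncomputable section

open CategoryTheory Function Set

universe u w

namespace Literature.AlgebraicTopology.SingularHomology

namespace LerayHirsch

/-! ### Height functions of a countable increasing open cover -/

section Height

variable {B : Type u} [TopologicalSpace B] (V : ℕ → Set B)

/-- A **height function** for an increasing cover `(Vₙ)`: a continuous `h ≥ 0` with `b ∈ Vₙ`
whenever `h(b) ≤ n`. [cite: HatcherAT2002, §4.D (telescope arguments)] -/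
structure HeightFun where
  /-- the function -/
  toFun : C(B, ℝ)
  /-- it is nonnegative -/
  nonneg : ∀ b, 0 ≤ toFun b
  /-- `h(b) ≤ n ⇒ b ∈ Vₙ` -/
  mem_of_le : ∀ (b : B) (n : ℕ), toFun b ≤ n → b ∈ V n

/-- **Existence of height functions** on a normal paracompact space, for an increasing countable
open cover: `h = Σₙ n ρₙ` for a partition of unity `ρ` subordinate to `(Vₙ)` (if `h(b) ≤ N` some
`ρₙ(b) ≠ 0` with `n ≤ N`, so `b ∈ Vₙ ⊆ V_N`). [cite: HatcherAT2002, §4.D (telescope arguments)] -/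
theorem exists_heightFun [NormalSpace B] [ParacompactSpace B] (hVo : ∀ n, IsOpen (V n)) (hmono : Monotone V)
    (hcov : ⋃ n, V n = univ) : Nonempty (HeightFun V) := by
  obtain ⟨ρ, hρ⟩ := PartitionOfUnity.exists_isSubordinate isClosed_univ V hVo (by rw [hcov])
  have hcont : Continuous fun b ↦ ∑ᶠ n, ρ n b • (n : ℝ) :=
    ρ.continuous_finsum_smul (g := fun n _ ↦ (n : ℝ)) fun n b _ ↦ continuousAt_const
  have hsum : ∀ b, ∑ᶠ n, ρ n b • (n : ℝ) = ∑ n ∈ ρ.finsupport b, ρ n b • (n : ℝ) := fun b ↦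
    (ρ.sum_finsupport_smul_eq_finsum (x₀ := b) (fun n _ ↦ (n : ℝ))).symm
  refine ⟨⟨⟨fun b ↦ ∑ᶠ n, ρ n b • (n : ℝ), hcont⟩, fun b ↦ ?_, fun b N hN ↦ ?_⟩⟩
  · change 0 ≤ ∑ᶠ n, ρ n b • (n : ℝ)
    rw [hsum]
    exact Finset.sum_nonneg fun n _ ↦ smul_nonneg (ρ.nonneg n b) (Nat.cast_nonneg n)
  · change ∑ᶠ n, ρ n b • (n : ℝ) ≤ N at hN
    rw [hsum] at hN
    by_contra hb
    -- every `n` in the support is `> N`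
    have hlt : ∀ n ∈ ρ.finsupport b, (N : ℝ) + 1 ≤ n := fun n hn ↦ by
      have hn' : ρ n b ≠ 0 := by simpa [PartitionOfUnity.mem_finsupport] using hn
      have hbn : b ∈ V n := hρ n (subset_tsupport _ hn')
      have : ¬n ≤ N := fun h ↦ hb (hmono h hbn)
      exact_mod_cast (show N + 1 ≤ n by omega)
    have h1 : ∑ n ∈ ρ.finsupport b, ρ n b = 1 := ρ.sum_finsupport (mem_univ b)
    have : (N : ℝ) + 1 ≤ ∑ n ∈ ρ.finsupport b, ρ n b • (n : ℝ) := by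
      calc (N : ℝ) + 1 = ∑ n ∈ ρ.finsupport b, ρ n b • ((N : ℝ) + 1) := by
            rw [← Finset.sum_smul, h1, one_smul]
        _ ≤ ∑ n ∈ ρ.finsupport b, ρ n b • (n : ℝ) :=
            Finset.sum_le_sum fun n hn ↦ smul_le_smul_of_nonneg_left (hlt n hn) (ρ.nonneg n b)
    linarith

end Height

/-! ### The telescope of an increasing sequence of subsets -/

section Telescope

variable {B : Type u} (V : ℕ → Set B)

/-- The box `Vₙ × (n, n + 2)`. [cite: Milnor1962, Lemma 1 (proof)] -/
def telBox (n : ℕ) : Set (B × ℝ) := V n ×ˢ Ioo (n : ℝ) (n + 2)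

/-- The even boxes. [cite: Milnor1962, Lemma 1 (proof)] -/
def telEven : Set (B × ℝ) := ⋃ n, telBox V (2 * n)

/-- The odd boxes. [cite: Milnor1962, Lemma 1 (proof)] -/
def telOdd : Set (B × ℝ) := ⋃ n, telBox V (2 * n + 1)

/-- **The (open) telescope** `T = ⋃ₙ Vₙ × (n, n + 2) ⊆ B × ℝ`. [cite: Milnor1962, Lemma 1] -/
def tel : Set (B × ℝ) := telEven V ∪ telOdd V

variable {V}

/-- Membership in a box. [folklore] -/
theorem mem_telBox {n : ℕ} {x : B × ℝ} : x ∈ telBox V n ↔ x.1 ∈ V n ∧ (n : ℝ) < x.2 ∧ x.2 < n + 2 := by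
  simp only [telBox, mem_prod, mem_Ioo]

/-- Two boxes of width `2` meeting have indices at distance `≤ 1`. [folklore] -/
theorem le_of_mem_telBox {a b : ℕ} {t : ℝ} (ha : (a : ℝ) < t) (ha' : t < a + 2) (hb : (b : ℝ) < t) (hb' : t < b + 2) :
    a ≤ b + 1 ∧ b ≤ a + 1 := by
  have h₁ : (a : ℝ) < ((b + 2 : ℕ) : ℝ) := by push_cast; linarith
  have h₂ : (b : ℝ) < ((a + 2 : ℕ) : ℝ) := by push_cast; linarith
  have := Nat.cast_lt.1 h₁
  have := Nat.cast_lt.1 h₂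
  omega

/-- Every box lies in the telescope. [folklore] -/
theorem telBox_subset_tel (n : ℕ) : telBox V n ⊆ tel V := by
  intro x hx
  rcases Nat.even_or_odd n with ⟨k, rfl⟩ | ⟨k, rfl⟩
  · exact Or.inl (mem_iUnion.2 ⟨k, by rwa [two_mul]⟩)
  · exact Or.inr (mem_iUnion.2 ⟨k, hx⟩)

/-- **Membership in the telescope** of an increasing sequence: `(b, t) ∈ T ⇔ b ∈ Vₙ` for some
`n < t` (so the fibres of `T → B` are rays). [cite: Milnor1962, Lemma 1 (proof)] -/
theorem mem_tel_iff (hmono : Monotone V) (x : B × ℝ) : x ∈ tel V ↔ ∃ n, x.1 ∈ V n ∧ (n : ℝ) < x.2 := by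
  constructor
  · rintro (hx | hx)
    · obtain ⟨k, hk⟩ := mem_iUnion.1 hx
      exact ⟨2 * k, (mem_telBox.1 hk).1, (mem_telBox.1 hk).2.1⟩
    · obtain ⟨k, hk⟩ := mem_iUnion.1 hx
      exact ⟨2 * k + 1, (mem_telBox.1 hk).1, (mem_telBox.1 hk).2.1⟩
  · rintro ⟨n, hn, hnt⟩
    have ht0 : 0 < x.2 := lt_of_le_of_lt (Nat.cast_nonneg n) hnt
    have hc1 : 1 ≤ ⌈x.2⌉₊ := Nat.ceil_pos.2 ht0
    set m : ℕ := ⌈x.2⌉₊ - 1 with hm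
    have hmR : (m : ℝ) = ⌈x.2⌉₊ - 1 := by rw [hm, Nat.cast_sub hc1, Nat.cast_one]
    have hnm : n ≤ m := by
      have : (n : ℝ) < ⌈x.2⌉₊ := lt_of_lt_of_le hnt (Nat.le_ceil _)
      have := Nat.cast_lt.1 this
      omega
    refine telBox_subset_tel m (mem_telBox.2 ⟨hmono hnm hn, ?_, ?_⟩)
    · rw [hmR]; linarith [Nat.ceil_lt_add_one ht0.le]
    · rw [hmR]; linarith [Nat.le_ceil x.2]

/-- The even boxes are pairwise disjoint. [cite: Milnor1962, Lemma 1 (proof)] -/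
theorem pairwise_disjoint_telBox_even : Pairwise (Disjoint on fun n ↦ telBox V (2 * n)) := by
  intro n m hnm
  refine disjoint_left.2 fun x hx hx' ↦ hnm ?_
  obtain ⟨-, h1, h2⟩ := mem_telBox.1 hx
  obtain ⟨-, h3, h4⟩ := mem_telBox.1 hx'
  push_cast at h1 h2 h3 h4
  have := le_of_mem_telBox (a := 2 * n) (b := 2 * m) (by push_cast; exact h1) (by push_cast; exact h2)
    (by push_cast; exact h3) (by push_cast; exact h4)
  omega

/-- The odd boxes are pairwise disjoint. [cite: Milnor1962, Lemma 1 (proof)] -/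
theorem pairwise_disjoint_telBox_odd : Pairwise (Disjoint on fun n ↦ telBox V (2 * n + 1)) := by
  intro n m hnm
  refine disjoint_left.2 fun x hx hx' ↦ hnm ?_
  obtain ⟨-, h1, h2⟩ := mem_telBox.1 hx
  obtain ⟨-, h3, h4⟩ := mem_telBox.1 hx'
  have := le_of_mem_telBox (a := 2 * n + 1) (b := 2 * m + 1) (by push_cast at h1 ⊢; exact h1)
    (by push_cast at h2 ⊢; exact h2) (by push_cast at h3 ⊢; exact h3) (by push_cast at h4 ⊢; exact h4)
  omega

/-- Consecutive boxes meet in boxes of width `1`, which are pairwise disjoint. [cite: Milnor1962, Lemma 1 (proof)] -/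
theorem pairwise_disjoint_telBox_inter : Pairwise (Disjoint on fun k ↦ telBox V k ∩ telBox V (k + 1)) := by
  intro n m hnm
  refine disjoint_left.2 fun x hx hx' ↦ hnm ?_
  obtain ⟨-, -, h2⟩ := mem_telBox.1 hx.1
  obtain ⟨-, h3, -⟩ := mem_telBox.1 hx.2
  obtain ⟨-, -, h6⟩ := mem_telBox.1 hx'.1
  obtain ⟨-, h7, -⟩ := mem_telBox.1 hx'.2
  have e₁ : ((n + 1 : ℕ) : ℝ) < ((m + 2 : ℕ) : ℝ) := by push_cast at h3 h6 ⊢; linarith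
  have e₂ : ((m + 1 : ℕ) : ℝ) < ((n + 2 : ℕ) : ℝ) := by push_cast at h7 h2 ⊢; linarith
  have := Nat.cast_lt.1 e₁
  have := Nat.cast_lt.1 e₂
  omega

/-- **The even and the odd part meet in the disjoint union of the boxes `Vₖ × (k + 1, k + 2)`.**
[cite: Milnor1962, Lemma 1 (proof)] -/
theorem telEven_inter_telOdd : telEven V ∩ telOdd V = ⋃ k, telBox V k ∩ telBox V (k + 1) := by
  ext x
  simp only [telEven, telOdd, mem_inter_iff, mem_iUnion]
  constructor
  · rintro ⟨⟨n, hn⟩, ⟨m, hm⟩⟩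
    obtain ⟨-, h1, h2⟩ := mem_telBox.1 hn
    obtain ⟨-, h3, h4⟩ := mem_telBox.1 hm
    have := le_of_mem_telBox (a := 2 * n) (b := 2 * m + 1) (by push_cast at h1 ⊢; exact h1)
      (by push_cast at h2 ⊢; exact h2) (by push_cast at h3 ⊢; exact h3) (by push_cast at h4 ⊢; exact h4)
    rcases Nat.lt_or_ge m n with h | h
    · -- `n = m + 1`: the boxes `2m + 1`, `2m + 2`
      refine ⟨2 * m + 1, hm, ?_⟩
      have e : 2 * m + 1 + 1 = 2 * n := by omega
      rw [e]; exact hn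
    · -- `n = m`: the boxes `2n`, `2n + 1`
      refine ⟨2 * n, hn, ?_⟩
      have e : 2 * n + 1 = 2 * m + 1 := by omega
      rw [e]; exact hm
  · rintro ⟨k, hk, hk'⟩
    rcases Nat.even_or_odd k with ⟨j, rfl⟩ | ⟨j, rfl⟩
    · refine ⟨⟨j, by rwa [two_mul]⟩, ⟨j, ?_⟩⟩
      have e : 2 * j + 1 = j + j + 1 := by omega
      rw [e]; exact hk'
    · refine ⟨⟨j + 1, ?_⟩, ⟨j, hk⟩⟩
      have e : 2 * (j + 1) = 2 * j + 1 + 1 := by omega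
      rw [e]; exact hk'

/-- Consecutive boxes meet in the box over `Vₖ` with the interval `(k, k+2) ∩ (k+1, k+3)`.
[folklore] -/
theorem telBox_inter_succ (hmono : Monotone V) (k : ℕ) :
    telBox V k ∩ telBox V (k + 1) = V k ×ˢ (Ioo (k : ℝ) (k + 2) ∩ Ioo ((k + 1 : ℕ) : ℝ) ((k + 1 : ℕ) + 2)) := by
  rw [telBox, telBox, prod_inter_prod, inter_eq_left.2 (hmono (Nat.le_succ k))]

variable [TopologicalSpace B]

/-- The boxes are open. [folklore] -/
theorem isOpen_telBox (hVo : ∀ n, IsOpen (V n)) (n : ℕ) : IsOpen (telBox V n) := (hVo n).prod isOpen_Ioo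

/-- The even part is open. [folklore] -/
theorem isOpen_telEven (hVo : ∀ n, IsOpen (V n)) : IsOpen (telEven V) := isOpen_iUnion fun _ ↦ isOpen_telBox hVo _

/-- The odd part is open. [folklore] -/
theorem isOpen_telOdd (hVo : ∀ n, IsOpen (V n)) : IsOpen (telOdd V) := isOpen_iUnion fun _ ↦ isOpen_telBox hVo _

end Telescope

/-! ### The telescope retracts onto the base by a homotopy equivalence -/

section Retract

variable {B : Type u} [TopologicalSpace B] {V : ℕ → Set B} {Y : Type u} [TopologicalSpace Y]
  (g : C(Y, B)) (S : Set (Y × ℝ)) (H : HeightFun V) (hS : ∀ (y : Y) (t : ℝ), (y, t) ∈ S ↔ ∃ n, g y ∈ V n ∧ (n : ℝ) < t)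

/-- The projection `S → Y` of a telescope-like subset `S ⊆ Y × ℝ`. [folklore] -/
def telFst : C(↥S, Y) := ⟨fun x ↦ x.1.1, continuous_fst.comp continuous_subtype_val⟩

include hS in
/-- `(y, h(g y) + 1) ∈ S`. [folklore] -/
theorem mk_height_mem (y : Y) : (y, H.toFun (g y) + 1) ∈ S :=
  (hS _ _).2 ⟨⌈H.toFun (g y)⌉₊, H.mem_of_le _ _ (Nat.le_ceil _), Nat.ceil_lt_add_one (H.nonneg _)⟩

/-- The section `y ↦ (y, h(g y) + 1)` of `S → Y` given by a height function. [cite: HatcherAT2002, §4.D (telescope arguments)] -/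
def telSec : C(Y, ↥S) where
  toFun y := ⟨(y, H.toFun (g y) + 1), mk_height_mem g S H hS y⟩
  continuous_toFun := (continuous_id.prodMk ((H.toFun.continuous.comp g.continuous).add continuous_const)).subtype_mk _

/-- `pr ∘ sec = 𝟙`. [folklore] -/
theorem telFst_comp_telSec : (telFst S).comp (telSec g S H hS) = ContinuousMap.id Y := rfl

include hS in
/-- The fibres of `S → Y` are convex upwards rays: points between `(y, t) ∈ S` and the section stay
in `S`. [folklore] -/
theorem mem_of_between {y : Y} {t : ℝ} (ht : (y, t) ∈ S) (τ : unitInterval) :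
    (y, (1 - (τ : ℝ)) * (H.toFun (g y) + 1) + τ * t) ∈ S := by
  obtain ⟨n₁, hn₁, hlt₁⟩ := (hS _ _).1 ht
  obtain ⟨n₂, hn₂, hlt₂⟩ := (hS _ _).1 (mk_height_mem g S H hS y)
  set a : ℝ := H.toFun (g y) + 1
  set t' : ℝ := (1 - (τ : ℝ)) * a + τ * t
  have hmin : min a t ≤ t' :=
    calc min a t = (1 - (τ : ℝ)) * min a t + τ * min a t := by ring
      _ ≤ t' := add_le_add (mul_le_mul_of_nonneg_left (min_le_left _ _) (sub_nonneg.2 τ.2.2))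
          (mul_le_mul_of_nonneg_left (min_le_right _ _) τ.2.1)
  by_cases h : (n₂ : ℝ) < t'
  · exact (hS _ _).2 ⟨n₂, hn₂, h⟩
  · have hlt : t' < a := lt_of_le_of_lt (not_lt.1 h) hlt₂
    have htt' : t ≤ t' := by
      rcases min_le_iff.1 hmin with h' | h'
      · exact absurd h' (not_le.2 hlt)
      · exact h'
    exact (hS _ _).2 ⟨n₁, hn₁, lt_of_lt_of_le hlt₁ htt'⟩

/-- The straight-line homotopy from `sec ∘ pr` to the identity of `S`. [cite: HatcherAT2002, §4.D (telescope arguments)] -/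
def telHomotopy : ContinuousMap.Homotopy ((telSec g S H hS).comp (telFst S)) (ContinuousMap.id ↥S) where
  toFun z := ⟨(z.2.1.1, (1 - (z.1 : ℝ)) * (H.toFun (g z.2.1.1) + 1) + z.1 * z.2.1.2),
    mem_of_between g S H hS z.2.2 z.1⟩
  continuous_toFun := by
    refine Continuous.subtype_mk (Continuous.prodMk ?_ ?_) _
    · exact continuous_fst.comp (continuous_subtype_val.comp continuous_snd)
    · refine Continuous.add (Continuous.mul ?_ ?_) (Continuous.mul ?_ ?_)
      · exact continuous_const.sub (continuous_subtype_val.comp continuous_fst)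
      · exact ((H.toFun.continuous.comp g.continuous).comp
          (continuous_fst.comp (continuous_subtype_val.comp continuous_snd))).add continuous_const
      · exact continuous_subtype_val.comp continuous_fst
      · exact continuous_snd.comp (continuous_subtype_val.comp continuous_snd)
  map_zero_left x := by
    refine Subtype.ext (Prod.ext rfl ?_)
    simp [telSec, telFst]
  map_one_left x := by
    refine Subtype.ext (Prod.ext rfl ?_)
    simp

/-- **`S → Y` is a homotopy equivalence** (section from a height function, straight-line homotopy
in the rays). [cite: HatcherAT2002, §4.D (telescope arguments)] -/
def telHomotopyEquiv : ContinuousMap.HomotopyEquiv ↥S Y where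
  toFun := telFst S
  invFun := telSec g S H hS
  left_inv := ⟨telHomotopy g S H hS⟩
  right_inv := by rw [telFst_comp_telSec]

include g H hS in
/-- `pr^* : Hⁿ(Y) → Hⁿ(S)` is bijective. [cite: HatcherAT2002, §3.1 p. 201 (homotopy invariance)] -/
theorem map_telFst_bijective (R : Type u) [CommRing R] (n : ℕ) :
    Bijective (singularCohomology.map R R (telFst S) n) :=
  (singularCohomology.isoOfHomotopyEquiv' R R (telHomotopyEquiv g S H hS) n).toLinearEquiv.bijective

end Retract

/-! ### Boxes, and the exhaustion theorem -/

variable (R : Type u) [CommRing R] {ι : Type w} [Fintype ι] (d : ι → ℕ)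
variable {X B : Type u} [TopologicalSpace X] [TopologicalSpace B] (p : C(X, B)) (c : (j : ι) → singularCohomology R R X (d j))

/-- `p × 𝟙 : E × ℝ → B × ℝ`. [folklore] -/
abbrev prodR : C(X × ℝ, B × ℝ) := p.prodMap (ContinuousMap.id ℝ)

/-- The classes `pr₁^* cⱼ` on `E × ℝ`. [folklore] -/
abbrev clsR : (j : ι) → singularCohomology R R (X × ℝ) (d j) := fun j ↦
  singularCohomology.map R R (ContinuousMap.fst : C(X × ℝ, X)) (d j) (c j)

/-- `↥((p × 𝟙)⁻¹(S × J)) ≃ₜ ↥(p⁻¹S) × ↥J`. [folklore] -/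
def preBoxHomeomorph (S : Set B) (J : Set ℝ) : ↥((prodR p) ⁻¹' (S ×ˢ J)) ≃ₜ ↥(p ⁻¹' S) × ↥J where
  toFun x := (⟨x.1.1, (mem_prod.1 x.2).1⟩, ⟨x.1.2, (mem_prod.1 x.2).2⟩)
  invFun y := ⟨(y.1.1, y.2.1), mem_prod.2 ⟨y.1.2, y.2.2⟩⟩
  left_inv _ := rfl
  right_inv _ := rfl
  continuous_toFun := ((continuous_fst.comp continuous_subtype_val).subtype_mk _).prodMk
    ((continuous_snd.comp continuous_subtype_val).subtype_mk _)
  continuous_invFun := ((continuous_subtype_val.comp continuous_fst).prodMk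
    (continuous_subtype_val.comp continuous_snd)).subtype_mk _

/-- `↥(S × J) ≃ₜ ↥S × ↥J`. [folklore] -/
def boxHomeomorph (S : Set B) (J : Set ℝ) : ↥(S ×ˢ J) ≃ₜ ↥S × ↥J where
  toFun x := (⟨x.1.1, (mem_prod.1 x.2).1⟩, ⟨x.1.2, (mem_prod.1 x.2).2⟩)
  invFun y := ⟨(y.1.1, y.2.1), mem_prod.2 ⟨y.1.2, y.2.2⟩⟩
  left_inv _ := rfl
  right_inv _ := rfl
  continuous_toFun := ((continuous_fst.comp continuous_subtype_val).subtype_mk _).prodMk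
    ((continuous_snd.comp continuous_subtype_val).subtype_mk _)
  continuous_invFun := ((continuous_subtype_val.comp continuous_fst).prodMk
    (continuous_subtype_val.comp continuous_snd)).subtype_mk _

/-- **`pr₁ : U × J → U` is a homotopy equivalence for `J ⊆ ℝ` convex** (inverse a slice,
straight-line homotopy in `J`). [cite: HatcherAT2002, Ch. 0 p. 4] -/
def fstConvexHomotopyEquiv {U : Type u} [TopologicalSpace U] {J : Set ℝ} (hJ : Convex ℝ J) {j₀ : ℝ} (hj₀ : j₀ ∈ J) :
    ContinuousMap.HomotopyEquiv (U × ↥J) U where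
  toFun := ContinuousMap.fst
  invFun := (ContinuousMap.id U).prodMk (ContinuousMap.const U ⟨j₀, hj₀⟩)
  left_inv := ⟨
    { toFun := fun z ↦ (z.2.1, ⟨(1 - (z.1 : ℝ)) * j₀ + z.1 * z.2.2,
        hJ hj₀ z.2.2.2 (sub_nonneg.2 z.1.2.2) z.1.2.1 (sub_add_cancel 1 _)⟩)
      continuous_toFun := (continuous_fst.comp continuous_snd).prodMk
        ((((continuous_const.sub (continuous_subtype_val.comp continuous_fst)).mul continuous_const).add
          ((continuous_subtype_val.comp continuous_fst).mul
            (continuous_subtype_val.comp (continuous_snd.comp continuous_snd)))).subtype_mk _)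
      map_zero_left := fun z ↦ Prod.ext rfl (Subtype.ext (by simp))
      map_one_left := fun z ↦ Prod.ext rfl (Subtype.ext (by simp)) }⟩
  right_inv := ContinuousMap.Homotopic.refl _

/-- `(pr₁ ∘ e)^*` is bijective for a homeomorphism `e : Z ≃ₜ U × J`, `J ⊆ ℝ` convex nonempty.
[cite: HatcherAT2002, §3.1 p. 201 (homotopy invariance)] -/
theorem map_fst_comp_homeomorph_bijective {Z U : Type u} [TopologicalSpace Z] [TopologicalSpace U] {J : Set ℝ}
    (hJ : Convex ℝ J) {j₀ : ℝ} (hj₀ : j₀ ∈ J) (e : Z ≃ₜ U × ↥J) (n : ℕ) :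
    Bijective (singularCohomology.map R R ((ContinuousMap.fst : C(U × ↥J, U)).comp (e : C(Z, U × ↥J))) n) := by
  rw [singularCohomology.map_comp]
  exact (singularCohomology.mapIso R R e n).toLinearEquiv.bijective.comp
    (singularCohomology.isoOfHomotopyEquiv' R R (fstConvexHomotopyEquiv (U := U) hJ hj₀) n).toLinearEquiv.bijective

/-- The box square commutes: `p| ∘ (pr₁ ∘ e) = (pr₁ ∘ e) ∘ (p × 𝟙)|`. [folklore] -/
theorem resMap_comp_box (S : Set B) (J : Set ℝ) :
    (resMap p S).comp ((ContinuousMap.fst : C(↥(p ⁻¹' S) × ↥J, ↥(p ⁻¹' S))).comp (preBoxHomeomorph p S J : C(_, _))) =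
      ((ContinuousMap.fst : C(↥S × ↥J, ↥S)).comp (boxHomeomorph S J : C(_, _))).comp (resMap (prodR p) (S ×ˢ J)) :=
  ContinuousMap.ext fun _ ↦ rfl

omit [Fintype ι] in
/-- The box square matches the classes. [folklore] -/
theorem map_box_resCls (S : Set B) (J : Set ℝ) (j : ι) :
    singularCohomology.map R R ((ContinuousMap.fst : C(↥(p ⁻¹' S) × ↥J, ↥(p ⁻¹' S))).comp (preBoxHomeomorph p S J : C(_, _)))
      (d j) (resCls p S c j) = resCls (prodR p) (S ×ˢ J) (clsR R d c) j := by
  change singularCohomology.map R R _ (d j) (singularCohomology.map R R (subsetIncl (p ⁻¹' S)) (d j) (c j)) =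
    singularCohomology.map R R (subsetIncl ((prodR p) ⁻¹' (S ×ˢ J))) (d j)
      (singularCohomology.map R R (ContinuousMap.fst : C(X × ℝ, X)) (d j) (c j))
  rw [← ModuleCat.comp_apply, ← singularCohomology.map_comp, ← ModuleCat.comp_apply, ← singularCohomology.map_comp]
  rfl

/-- **A box is as good as its base**: `θ` is bijective over `S × J ⊆ B × ℝ` (for `p × 𝟙` and the
classes `pr₁^* cⱼ`) iff it is bijective over `S`, for `J ⊆ ℝ` convex nonempty.
[cite: HatcherAT2002, §3.1 p. 201 (homotopy invariance)] -/
theorem isLH_box_iff {S : Set B} {J : Set ℝ} (hJ : Convex ℝ J) (hJne : J.Nonempty) :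
    IsLH R d (prodR p) (clsR R d c) (S ×ˢ J) ↔ IsLH R d p c S := by
  obtain ⟨j₀, hj₀⟩ := hJne
  have hf := map_fst_comp_homeomorph_bijective R hJ hj₀ (preBoxHomeomorph p S J)
  have hg := map_fst_comp_homeomorph_bijective R hJ hj₀ (boxHomeomorph S J)
  have key := bijective_iff_of_square R d (resMap p S) (resMap (prodR p) (S ×ˢ J)) _ _ (resMap_comp_box p S J)
    (resCls p S c) (resCls (prodR p) (S ×ˢ J) (clsR R d c)) (map_box_resCls R d p c S J) hf hg
  unfold IsLH
  exact key.symm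

/-- **Leray–Hirsch for an increasing open exhaustion** (Husemoller 17 §1 Thm. 1.1 with Rem. 1.2,
via Milnor's telescope): if `B = ⋃ Vₙ` with `Vₙ` open increasing and `θ` is bijective over every
`Vₙ`, then `θ : Π_{d j ≤ k} Hᵏ⁻ᵈʲ(B) → Hᵏ(E)` is bijective (for `B` normal paracompact).
[cite: HusemollerFibreBundles1994, Ch. 17 §1 Thm. 1.1, Rem. 1.2] [cite: Milnor1962, Lemma 1] -/
theorem bijective_of_exhaustion [NormalSpace B] [ParacompactSpace B] {V : ℕ → Set B} (hVo : ∀ n, IsOpen (V n))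
    (hmono : Monotone V) (hcov : ⋃ n, V n = univ) (h : ∀ n, IsLH R d p c (V n)) (k : ℕ) :
    Bijective (lhMap R d p c k) := by
  obtain ⟨H⟩ := exists_heightFun V hVo hmono hcov
  -- `θ` over the boxes, the even / odd parts, their intersection, the telescope
  have hbox : ∀ n, IsLH R d (prodR p) (clsR R d c) (telBox V n) := fun n ↦
    (isLH_box_iff R d p c (convex_Ioo _ _) (nonempty_Ioo.2 (by linarith))).2 (h n)
  have heven : IsLH R d (prodR p) (clsR R d c) (telEven V) :=
    isLH_iUnion_of_pairwise_disjoint R d _ _ (fun n ↦ isOpen_telBox hVo _) pairwise_disjoint_telBox_even fun n ↦ hbox _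
  have hodd : IsLH R d (prodR p) (clsR R d c) (telOdd V) :=
    isLH_iUnion_of_pairwise_disjoint R d _ _ (fun n ↦ isOpen_telBox hVo _) pairwise_disjoint_telBox_odd fun n ↦ hbox _
  have hinter : IsLH R d (prodR p) (clsR R d c) (telEven V ∩ telOdd V) := by
    rw [isLH_congr R d _ _ telEven_inter_telOdd]
    refine isLH_iUnion_of_pairwise_disjoint R d _ _ (fun k ↦ (isOpen_telBox hVo _).inter (isOpen_telBox hVo _))
      pairwise_disjoint_telBox_inter fun k ↦ ?_
    rw [isLH_congr R d _ _ (telBox_inter_succ hmono k)]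
    refine (isLH_box_iff R d p c ((convex_Ioo _ _).inter (convex_Ioo _ _)) ⟨(k : ℝ) + 3 / 2, ?_⟩).2 (h k)
    refine ⟨⟨by linarith, by linarith⟩, ?_, ?_⟩ <;> push_cast <;> linarith
  have htel : IsLH R d (prodR p) (clsR R d c) (tel V) :=
    isLH_union R d _ _ (isOpen_telEven hVo) (isOpen_telOdd hVo) heven hodd hinter
  -- transport along the homotopy equivalences `T → B`, `(p × 𝟙)⁻¹ T → E`
  have hSB : ∀ (b : B) (t : ℝ), (b, t) ∈ tel V ↔ ∃ n, (ContinuousMap.id B) b ∈ V n ∧ (n : ℝ) < t := fun b t ↦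
    mem_tel_iff hmono (b, t)
  have hSX : ∀ (x : X) (t : ℝ), (x, t) ∈ (prodR p) ⁻¹' tel V ↔ ∃ n, p x ∈ V n ∧ (n : ℝ) < t := fun x t ↦
    mem_tel_iff hmono (p x, t)
  exact (bijective_iff_of_square R d p (resMap (prodR p) (tel V)) (telFst ((prodR p) ⁻¹' tel V)) (telFst (tel V)) rfl
    c (resCls (prodR p) (tel V) (clsR R d c)) (fun j ↦ by
      change _ = singularCohomology.map R R _ (d j) (singularCohomology.map R R _ (d j) (c j))
      rw [← ModuleCat.comp_apply, ← singularCohomology.map_comp]; rfl)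
    (map_telFst_bijective p _ H hSX R) (map_telFst_bijective (ContinuousMap.id B) _ H hSB R)).2 htel k

end LerayHirsch

end Literature.AlgebraicTopology.SingularHomology
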